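import Summits.AtomisticToContinuum.Crystallization.Theorems.ChartedZeroExcessLayeredLatticeLiouvilleD

/-!
# ChartedZeroExcessLayered · LatticeLiouville — part E/8: §D «LayeredLiouville», the layered side (decomp-a2c lens-2 g24 `LatticeLiouville.lean` v8 sha256 4defadc6…, lines 1066–1322,
split at the `##` / `###` doc-heading boundaries for the gate's 400-line limit (cut table of critic row 444, §C cut once more at §C‴); content byte-identical; ONE
namespace `…Theorems.ChartedZeroExcessLayeredLatticeLiouville` across the parts, linear import chain.
-/

noncomputable section

open scoped BigOperators InnerProductSpace RealInnerProductSpace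
open MeasureTheory Set Metric
open Summit.AtomisticToContinuum.Crystallization.Theorems.ChartedPlanarOrderRigidityDoor (E3 IsClean IsNash IsCharted VisibleGap PertRegime atomsIn)
open Summit.AtomisticToContinuum.Crystallization.Theorems.ChartedPlanarOrderDensityDichotomy (μS IsSep)
open Summit.AtomisticToContinuum.Crystallization.Theorems.ChartedPlanarOrderMesoCut (IsDoorSet NearHom LayeredHom EnvClose)
open Summit.AtomisticToContinuum.Crystallization.Theorems.OverbindingBudgetLiouvilleDictionary (NearHomBD nearHom_of_nearHomBD)
open Summit.AtomisticToContinuum.Crystallization.Theorems.ChartedPlanarOrderDoorLayered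
  (TwoPeriodic not_twoPeriodic_singleton DoorHomogeneityBD DoorPeriodic PeriodicBulkGapDoor PeriodicBulkGap
   doorPeriodic_of_doorHomogeneityBD gap_and_pert_1_50_of_periodic gap_and_pert_1_50_of_periodic'
   NearHomL2BD CleanScaleCoherenceL2BD FlatnessExactL2BD doorPeriodic_of_L2 cleanScaleCoherenceL2BD_of_large nearHomL2BD_mono Layered)
open Summit.AtomisticToContinuum.Crystallization.Theorems.ChartedPlanarOrderDoorLayeredOsc
  (IsTwoShellAffineGood OscillationImprovement DoorPeriodicOsc doorPeriodic_of_osc doorPeriodicOsc_of_doorPeriodic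
   oscillationImprovement_of_ge)
open Literature.MathematicalPhysics.StatisticalMechanics (triangularVec₁ triangularVec₂)

namespace Summit.AtomisticToContinuum.Crystallization.Theorems.ChartedZeroExcessLayeredLatticeLiouville

/-! ## §D  «LayeredLiouville» (generation 24) — the APERIODIC-STACKING extension: the linear statics Liouville theorem for LAYERED structures
`Layered a b w` (cells `ℤ²`, index set `ℤ` = layers, ANY stacking word `w`), and the split of the declared residual P beneath it

THE GAP IT CLOSES (critic row 433 (B), P's first typed gap (a), accepted as stated): P `LinearisedFlatnessExact` linearises the Nash equations at
the window's own layered chart `LayeredHom L w`, whose stacking word `w : ℤ → E3` need NOT be periodic, while `LatticeLiouvilleCert` (§B)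
certifies PERIODIC multilattices only.  §A's kernel is already general in the index type `ι`; §D instantiates it at `ι = ℤ` on the tree's
gauge-free layered family `Layered a b w` (`…DoorLayeredExact`, `layeredHom_eq_layered`): sites `lsite a b w γ m = γ₀ a + γ₁ b + w m`, kernel
`layeredKernel a b w δ i j = forceConst (lsite δ j − lsite 0 i)` — cell-translation-invariant, layer-pair dependent, no periodicity anywhere.

KEY POINT (why no slaving / profile input is needed for the Liouville that P consumes): at `d = 2`, `ι = ℤ` the conclusion `IsAffine u` reads
`u γ m = γ₀ a′ + γ₁ b′ + c m` — ONE in-plane macroscopic gradient plus FREE per-layer constants `c m` — which is EXACTLY the tangent space of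
the chart family `Layered a b ·` (per-layer translations are absorbed, tree `layeredHom_translate`).  The normal-strain / registry modes of the
layer chain (`m ↦ m • e + r m`, lens-3's profile-slaving territory) sit inside the free constants: they are affine, and the Liouville theorem
does not need to exclude them.  What it must exclude is (GENERIC) in-plane-oscillating bounded harmonic fields and (SPECIAL) non-constant
BOUNDED solutions of the layer chain — the lens dichotomy one level down:

* GENERIC  `BoundedFlat (layeredKernel a b w)`     — k∥ ≠ 0 emptied: bounded harmonic ⇒ cell-independent (3D problem, two Caccioppoli steps in
                                                     the CELL directions, where translation invariance survives the aperiodic stacking);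
* SPECIAL  `GammaKernelBdd (layeredKernel a b w)`  — k∥ = 0: bounded solutions of the 1D layer chain `Σ_j K̄ i j (v j − v i) = 0`,
                                                     `K̄ i j = Σ_δ forceConst(…)`, are translations (1D, SUBCRITICAL: one Caccioppoli step; second
                                                     supplier = lens-3's landed E1 kernels `…LayerChainLiouvilleTail{,L1,Slaving}` — the chain is
                                                     their `Φ` with the linear dictionary, margin K < λ from the 3-fold decoupling of every
                                                     interlayer block `K̄ i j = α_{|i−j|}(I − n⊗n) + β_{|i−j|} n⊗n` for every Barlow word);
* EXHAUSTION `linLiouville_of_boundedFlat_of_gammaKernelBdd` (§A v8) — PROVED, pure algebra, verbatim the periodic kernel with the bounded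
  special piece (the UNBOUNDED Γ-modes of the chain are genuine and affine, so `GammaKernel` itself is FALSE here and is not asked).

ENERGY SIDE in the layer-local currency (§A v8 `nnFormZ` / `CoerciveZ` / `Moment₂Z`): `DecayFromCoercivityZ` (ATTACKABLE·M/L, structure-free,
typed as `LayeredDecay`), `LayeredMoments` (TRUE-type·S/M), and the LAYERED CENSUS CERTIFICATE `LayeredCrystalStability` (INSTRUMENTABLE, per
structure: census columns «POLYTYPE-BLOCH» — Bloch minima of the 2H/3C/4H/6H/9R polytypes, acoustic scaled by |k|² — and «CHAIN-MARGIN» — the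
in-plane lattice sums α_m, β_m of `forceConst` between layers at distance m ≥ 2 against the nearest-layer block: hand estimate per bond
V″(0.9712) ≈ 10.7 vs V″(1.586) ≈ −0.155, margin ≫ 1, word-independent; stable-sub-window caveat as for C).

THE SPLIT OF THE DECLARED RESIDUAL:  P(Λ, θ, κ) ⟸ P♭(Λ, θ, κ) ∧ L_lay,  L_lay ⟸ T_lay ∧ C_lay,  T_lay ⟸ LayeredDecay ∧ LayeredMoments
(`linearisedFlatnessExact_of_layered`, `layeredLiouvilleCert_of`, `layeredLinLiouville_of` — all PROVED), where
P♭ `LinearisedFlatnessLayered Λ θ κ := LatticeLiouvilleCert → LayeredLiouvilleCert → (P's binders) → TwoPeriodic Λ S` is P with its aperiodic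
linearisation input made an explicit hypothesis: WEAKER than P (`linearisedFlatnessLayered_of_exact`, one line), P♭ ⇏ P by cheap means (probe
MUST-FAIL), and what is moved out of the residual is NAMED content (3D Caccioppoli on a laminate + the 1D chain + a census column), every piece
strictly weaker than / incomparable with P and with N″.  P♭'s remaining content = the NONLINEAR ε-regularity and the iteration down the scales
(K_B² engine proper; UNDECIDED · DECLARED-RESIDUAL of g24).  P♭'s why-it-might-fail: (a′) the compactness form of the ε-regularity step consumes
the linear theorem with an L²-MEAN bounded gradient (Campanato currency) rather than the pointwise `BoundedGradient` — a STRONGER certificate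
`LinLiouvilleL2`; the Caccioppoli route to G/Γ^bdd only ever uses L² means, so the upgrade is a re-typing of hypotheses (deferred to the generation
that attacks `LayeredDecay`), not a new mechanism; (a″) the co-Lipschitz re-indexing of the limit structure (support-class); (b) the basin, as for P.
Continuum counterpart of T_lay in print (presearch 2026-08-31): elliptic systems «from composite material» / linear LAMINATES — coefficients depending
on ONE variable — have interior gradient estimates in all directions [galaxy:pdf:7850702777381559100 Li–Nirenberg, CPAM 2003; Chipot–Kinderlehrer–
Vergara-Caffarelli, ARMA 96 (1986), cite-level], laminate homogenisation is explicit 1D averaging [galaxy:panama:519630913273864 Blanc–Le Bris ch. on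
laminates], Campanato/Liouville for systems [corpus:giaquinta1984 pp.64–66, 145]; no corpus/galaxy hit for a DISCRETE layered/aperiodic-stacking
Liouville theorem ("Liouville theorem for discrete|stacking fault|polytype phonon" in galaxy pdf: none relevant); `lean search
'layeredKernel|LayeredLinLiouville|GammaKernelBdd|CoerciveZ|LinearisedFlatnessLayered'` → no hits.

REGISTRATION (critic row 433 (B), amended by census TAG 158 — §C⁗): θ = 1/16 BOOTSTRAP-FREE; the shared tolerance is SPLIT: R at the rigidity
level κ₁ = 1/16, P♭ at the basin level κ₀ = 4·(1/16)² = 1/64, joined by D `OscFlatnessDecay 2 (1/16) (1/16) (1/64)` (the N″-core, UNDECIDED):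
★★ `gap_and_pert_1_50_of_layered_pieces_16d` (nine Liouville-side leaves + HBG″) and its six-leaf packaging `gap_and_pert_1_50_of_certs_16d`
(`LatticeLiouvilleCert → LayeredLiouvilleCert → R(1/16) → D → P♭(1/64) → HBG″ → GAP ∧ PERT`, §D″); the two-piece columns `_16` / `_certs_16` (R at 1/64,
D folded into R) and the optimistic merge `_certs_16r` (R, P♭ both at 1/16, D folded into P♭) are kept as the two ways D can disappear; θ_osc = 1/32,
κ = 1/256 (+ `OscillationImprovement (1/32)`) is the FALLBACK literal (`gap_and_pert_1_50_of_layered_pieces_32`).  P♭'s basin κ₀ ≥ 1/64: PLAUSIBLE, not certified (TAG 154: affine-projected contraction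
c_nl = c_lin = 0.036 fcc / 0.040 hcp with every free site two-shell good up to pointwise misfit 0.035; κ = 1/64 ↔ rms environment misfit 1/8 —
contraction margin ×14 against the quadratic remainder; census ask «KORN-R / CAMP at rms 1/8»). -/

section LayeredSide

/-- site `(γ, m)` of the layered structure `Layered a b w` (tree `…DoorLayeredExact.Layered`, the gauge-free form of `LayeredHom L w`):
`γ₀ a + γ₁ b + w m` — in-plane cell `γ ∈ ℤ²`, layer `m ∈ ℤ`, the per-layer vector `w m` FREE (registry, inner displacement, height); no
periodicity of the stacking word is assumed anywhere in §D. -/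
def lsite (a b : E3) (w : ℤ → E3) (γ : Cell 2) (m : ℤ) : E3 :=
  (((γ 0 : ℤ) : ℝ) • a + ((γ 1 : ℤ) : ℝ) • b) + w m

/-- the tree's layered set is the range of the site map. -/
theorem layered_eq_range (a b : E3) (w : ℤ → E3) :
    Layered a b w = Set.range (fun x : Cell 2 × ℤ => lsite a b w x.1 x.2) := by
  ext p
  constructor
  · rintro ⟨m, i, j, rfl⟩
    refine ⟨(![i, j], m), ?_⟩
    simp [lsite]
  · rintro ⟨⟨γ, m⟩, rfl⟩
    exact ⟨m, γ 0, γ 1, rfl⟩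

/-- **the harmonic Lennard-Jones kernel of the layered structure** `(a, b, w)`: the bond force-constant operator at every bond
`lsite(δ, j) − lsite(0, i)` — cell-translation-invariant, layer-pair dependent, infinite range (same convention as `ljKernel`). -/
def layeredKernel (a b : E3) (w : ℤ → E3) : Cell 2 → ℤ → ℤ → (E3 →L[ℝ] E3) :=
  fun δ i j => if δ = 0 ∧ j = i then 0 else forceConst (lsite a b w δ j - lsite a b w 0 i)

/-- **a `c`-CO-LIPSCHITZ layered crystal**: the site map from the index lattice `ℤ² × ℤ` (sup metric) into space is `c`-co-Lipschitz — hence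
injective and `c`-separated (`isSep_of_isLayeredCrystal`), with layers indexed compatibly with their position in space (height-ordered, in-plane
offsets reduced).  Every separated layered set with independent in-plane generators admits such a parametrisation after re-indexing `w`
(support-class, S; chosen INSIDE P♭ for its limit structure) — the layer-local energy currency `nnFormZ` / `Moment₂Z` is stated in index distance,
and this is the hypothesis that makes index and Euclidean bookkeeping comparable.  Non-vacuous: `isLayeredCrystal_cubic`. -/
def IsLayeredCrystal (c : ℝ) (a b : E3) (w : ℤ → E3) : Prop :=
  ∀ x y : Cell 2 × ℤ, c * dist x y ≤ ‖lsite a b w x.1 x.2 - lsite a b w y.1 y.2‖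

/-- **per-structure layered stability certificate** (INSTRUMENTABLE: census «POLYTYPE-BLOCH» + «CHAIN-MARGIN»). -/
def LayeredStable (a b : E3) (w : ℤ → E3) : Prop :=
  ∃ κ : ℝ, 0 < κ ∧ CoerciveZ (layeredKernel a b w) κ

/-- **T_lay · `LayeredLinLiouville`** — THE TARGET OF §D (theorem-shaped, census-free): every co-Lipschitz, harmonically STABLE Lennard-Jones
layered structure — periodic stacking word or not — satisfies the linear statics Liouville theorem (bounded-gradient harmonic ⇒ ONE in-plane
gradient + FREE per-layer constants = the tangent of `Layered a b ·`). -/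
def LayeredLinLiouville : Prop :=
  ∀ (c : ℝ) (a b : E3) (w : ℤ → E3), 0 < c → IsLayeredCrystal c a b w → LayeredStable a b w → LinLiouville (layeredKernel a b w)

/-- the layered Caccioppoli steps (ATTACKABLE·M/L), typed STRUCTURE-FREE: every cell-translation-invariant layer-indexed kernel on `ℤ² × ℤ`
with values in `E3 →L[ℝ] E3` has the analytic reduction `DecayFromCoercivityZ` (why it might fail: only if the discrete Caccioppoli bookkeeping
needs more than the uniform second moment for infinitely many rows — then restrict to `layeredKernel`s of co-Lipschitz crystals, where every
moment is finite). -/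
def LayeredDecay : Prop :=
  ∀ K : Cell 2 → ℤ → ℤ → (E3 →L[ℝ] E3), DecayFromCoercivityZ K

/-- uniform second moments of the LJ force constants of a co-Lipschitz layered crystal (TRUE-type·S/M: `‖forceConst e‖ ≤ C(c)|e|⁻⁸` off `|e| ≥ c`,
index distance `≤ |e|/c`, rows = sums over a `c`-separated set of cubic growth, uniformly in the row). -/
def LayeredMoments : Prop :=
  ∀ (c : ℝ) (a b : E3) (w : ℤ → E3), 0 < c → IsLayeredCrystal c a b w → Moment₂Z (layeredKernel a b w)

/-- **C_lay · `LayeredCrystalStability`** — THE LAYERED CENSUS CERTIFICATE (INSTRUMENTABLE; per structure, `κ` not uniform): every co-Lipschitz LJ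
layered structure whose point set is (1/16, 9/10, 1)-two-shell CLEAN and single-site NASH (= the inner-relaxed clean Barlow stackings of ANY
stacking word, homogeneously strained within the clean window) is harmonically stable in the layer-local currency.  Why it might fail: a soft
interlayer-shear or breathing mode of some aperiodic word inside the clean window (census CHAIN-MARGIN says margin ≫ 1, word-independent);
stable-sub-window caveat as for C. -/
def LayeredCrystalStability : Prop :=
  ∀ (c : ℝ) (a b : E3) (w : ℤ → E3), 0 < c → IsLayeredCrystal c a b w →
    IsClean (μS (Layered a b w)) → IsNash (μS (Layered a b w)) → LayeredStable a b w

/-- **L_lay · `LayeredLiouvilleCert`** — what the aperiodic linearisation step of P consumes: clean ∧ Nash LJ layered structures (any stacking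
word) satisfy the linear statics Liouville theorem. -/
def LayeredLiouvilleCert : Prop :=
  ∀ (c : ℝ) (a b : E3) (w : ℤ → E3), 0 < c → IsLayeredCrystal c a b w →
    IsClean (μS (Layered a b w)) → IsNash (μS (Layered a b w)) → LinLiouville (layeredKernel a b w)

/-! ### symmetry of the layered kernel (proved) and separation of co-Lipschitz crystals -/

/-- reversing a bond of the layered structure: the bond from layer `j` in cell `0` to layer `i` in cell `−δ` is minus the bond from `i` in cell `0` to `j` in cell `δ`. -/
theorem lsite_neg_sub (a b : E3) (w : ℤ → E3) (δ : Cell 2) (i j : ℤ) :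
    lsite a b w (-δ) i - lsite a b w 0 j = -(lsite a b w δ j - lsite a b w 0 i) := by
  simp only [lsite, Pi.neg_apply, Int.cast_neg, neg_smul, Pi.zero_apply, Int.cast_zero, zero_smul, zero_add]
  abel

/-- **action–reaction symmetry of the layered kernel.** -/
theorem layeredKernel_symm (a b : E3) (w : ℤ → E3) : Symm (layeredKernel a b w) := by
  intro δ i j x y
  by_cases h : δ = 0 ∧ j = i
  · obtain ⟨rfl, rfl⟩ := h
    simp [layeredKernel]
  · have h' : ¬(-δ = 0 ∧ i = j) := fun hh => h ⟨by simpa using hh.1, hh.2.symm⟩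
    simp only [layeredKernel, h, h', if_false]
    rw [lsite_neg_sub, forceConst_neg, inner_forceConst_comm]

/-- **blockwise self-adjointness of the layered kernel.** -/
theorem layeredKernel_selfAdj (a b : E3) (w : ℤ → E3) : SelfAdj (layeredKernel a b w) := by
  intro δ i j x y
  by_cases h : δ = 0 ∧ j = i
  · obtain ⟨rfl, rfl⟩ := h
    simp [layeredKernel]
  · simp only [layeredKernel, h, if_false]
    rw [inner_forceConst_comm]

/-- distinct points of the index lattice `ℤ² × ℤ` are at sup-distance `≥ 1`. -/
theorem one_le_dist_of_ne {x y : Cell 2 × ℤ} (h : x ≠ y) : (1 : ℝ) ≤ dist x y := by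
  rw [Prod.dist_eq]
  by_cases h2 : x.2 = y.2
  · have h1 : x.1 ≠ y.1 := fun h1 => h (Prod.ext h1 h2)
    obtain ⟨k, hk⟩ : ∃ k, x.1 k ≠ y.1 k := by
      by_contra hcon
      push Not at hcon
      exact h1 (funext hcon)
    exact le_max_of_le_left ((Int.pairwise_one_le_dist hk).trans (dist_le_pi_dist x.1 y.1 k))
  · exact le_max_of_le_right (Int.pairwise_one_le_dist h2)

/-- a co-Lipschitz layered crystal is `c`-separated as a point set. -/
theorem isSep_of_isLayeredCrystal {c : ℝ} {a b : E3} {w : ℤ → E3} (h : IsLayeredCrystal c a b w) : IsSep c (Layered a b w) := by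
  intro p hp q hq hpq
  rw [layered_eq_range] at hp hq
  obtain ⟨x, rfl⟩ := hp
  obtain ⟨y, rfl⟩ := hq
  have hxy : x ≠ y := fun hxy => hpq (by rw [hxy])
  rcases le_or_gt 0 c with hc | hc
  · calc c = c * 1 := (mul_one c).symm
      _ ≤ c * dist x y := mul_le_mul_of_nonneg_left (one_le_dist_of_ne hxy) hc
      _ ≤ ‖lsite a b w x.1 x.2 - lsite a b w y.1 y.2‖ := h x y
      _ = dist (lsite a b w x.1 x.2) (lsite a b w y.1 y.2) := (dist_eq_norm _ _).symm
  · exact (hc.le.trans dist_nonneg)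

/-- a co-Lipschitz layered crystal (with `c > 0`) has an injective site map. -/
theorem injective_lsite_of_isLayeredCrystal {c : ℝ} (hc : 0 < c) {a b : E3} {w : ℤ → E3} (h : IsLayeredCrystal c a b w) :
    Function.Injective (fun x : Cell 2 × ℤ => lsite a b w x.1 x.2) := by
  intro x y hxy
  by_contra hne
  have h1 := h x y
  have h2 : 0 < c * dist x y := mul_pos hc (lt_of_lt_of_le one_pos (one_le_dist_of_ne hne))
  have h3 : ‖lsite a b w x.1 x.2 - lsite a b w y.1 y.2‖ = 0 := by
    rw [show lsite a b w x.1 x.2 = lsite a b w y.1 y.2 from hxy, sub_self, norm_zero]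
  linarith

/-- **NON-VACUITY of the family**: the simple-cubic layered structure `(e₀, e₁, m ↦ m • e₂)` is a `1`-co-Lipschitz layered crystal. -/
theorem isLayeredCrystal_cubic :
    IsLayeredCrystal 1 (EuclideanSpace.single 0 1) (EuclideanSpace.single 1 1)
      (fun m : ℤ => (m : ℝ) • EuclideanSpace.single (2 : Fin 3) (1 : ℝ)) := by
  intro x y
  rw [one_mul]
  set D : E3 := lsite (EuclideanSpace.single 0 1) (EuclideanSpace.single 1 1)
      (fun m : ℤ => (m : ℝ) • EuclideanSpace.single (2 : Fin 3) (1 : ℝ)) x.1 x.2 -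
    lsite (EuclideanSpace.single 0 1) (EuclideanSpace.single 1 1)
      (fun m : ℤ => (m : ℝ) • EuclideanSpace.single (2 : Fin 3) (1 : ℝ)) y.1 y.2 with hD
  -- the coordinates of `D`
  have hD0 : D 0 = (x.1 0 : ℝ) - (y.1 0 : ℝ) := by
    simp [hD, lsite]
  have hD1 : D 1 = (x.1 1 : ℝ) - (y.1 1 : ℝ) := by
    simp [hD, lsite]
  have hD2 : D 2 = (x.2 : ℝ) - (y.2 : ℝ) := by
    simp [hD, lsite]
  have hc : ∀ k : Fin 3, |D k| ≤ ‖D‖ := fun k => by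
    simpa [Real.norm_eq_abs] using PiLp.norm_apply_le D k
  rw [Prod.dist_eq]
  refine max_le ?_ ?_
  · refine (dist_pi_le_iff (norm_nonneg D)).2 fun k => ?_
    fin_cases k
    · have := hc 0
      rw [hD0] at this
      simpa [Int.dist_eq] using this
    · have := hc 1
      rw [hD1] at this
      simpa [Int.dist_eq] using this
  · have := hc 2
    rw [hD2] at this
    simpa [Int.dist_eq] using this

/-! ### the proved compositions on the layered side -/

/-- **T_lay ⟸ LayeredDecay ∧ LayeredMoments** (both symmetries discharged in-node). -/
theorem layeredLinLiouville_of (hD : LayeredDecay) (hM : LayeredMoments) : LayeredLinLiouville :=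
  fun c a b w hc hX hS =>
    linLiouville_of_decayZ (hD _) (layeredKernel_symm a b w) (layeredKernel_selfAdj a b w) (hM c a b w hc hX) hS

/-- **L_lay ⟸ T_lay ∧ C_lay.** -/
theorem layeredLiouvilleCert_of (hT : LayeredLinLiouville) (hC : LayeredCrystalStability) : LayeredLiouvilleCert :=
  fun c a b w hc hX hcl hna => hT c a b w hc hX (hC c a b w hc hX hcl hna)

/-- **L_lay ⟸ LayeredDecay ∧ LayeredMoments ∧ C_lay.** -/
theorem layeredLiouvilleCert_of_pieces (hD : LayeredDecay) (hM : LayeredMoments) (hC : LayeredCrystalStability) :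
    LayeredLiouvilleCert :=
  layeredLiouvilleCert_of (layeredLinLiouville_of hD hM) hC

/-- the generic and bounded-special pieces in layered-family form (for the record and the probes). -/
def LayeredBoundedFlat : Prop :=
  ∀ (c : ℝ) (a b : E3) (w : ℤ → E3), 0 < c → IsLayeredCrystal c a b w → LayeredStable a b w → BoundedFlat (layeredKernel a b w)

/-- **Γ_lay^bdd in family form**: every co-Lipschitz STABLE LJ layered structure has the BOUNDED special-fibre property `GammaKernelBdd (layeredKernel a b w)`
(the right special fibre for the infinite index set `ℤ`, §A). [this file] -/
def LayeredGammaKernelBdd : Prop :=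
  ∀ (c : ℝ) (a b : E3) (w : ℤ → E3), 0 < c → IsLayeredCrystal c a b w → LayeredStable a b w →
    GammaKernelBdd (layeredKernel a b w)

/-- **T_lay ⟸ G_lay ∧ Γ_lay^bdd in family form** (the lens cut one level down, PROVED). -/
theorem layeredLinLiouville_of_pieces (hG : LayeredBoundedFlat) (hΓ : LayeredGammaKernelBdd) : LayeredLinLiouville :=
  fun c a b w hc hX hS => linLiouville_of_boundedFlat_of_gammaKernelBdd (hG c a b w hc hX hS) (hΓ c a b w hc hX hS)

/-- **G_lay ⟸ T_lay in family form** (the generic piece is WEAKER, PROVED). -/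
theorem layeredBoundedFlat_of (hT : LayeredLinLiouville) : LayeredBoundedFlat :=
  fun c a b w hc hX hS => boundedFlat_of_linLiouville (hT c a b w hc hX hS)

end LayeredSide

end Summit.AtomisticToContinuum.Crystallization.Theorems.ChartedZeroExcessLayeredLatticeLiouville

end
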